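import Summits.Ventures.DiscreteObjects.Hadamard.CyclicCorePAF
import Summits.Ventures.DiscreteObjects.Hadamard.Order25TimesPrime668

/-!
# H(668): the cyclic-core dictionary at the primes 13, 37, 41, 83 and at order 111 (kernel) — every such automorphism is a
# family of `±1` sequences with prescribed autocorrelation sum

Framing: lottery ticket; floor = certified bounds/negative ranges.

Cell pub-namedobj (venture DiscreteObjects), target (H), hadamard gen 19.  Companion of `Order167GSQuad668` (order 167 = four
sequences with autocorrelation sum `0`: a Goethals–Seidel quadruple, family F2) and `Order333LegendrePair668` (order 333 = two
sequences with sum `−2`: a Legendre pair, family F3).  First a GENERAL statement (any Hadamard matrix, any odd prime):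
* **`hadamard_pafFamily_of_oddPrime`**: a Hadamard matrix `H` of order `N` with a signed automorphism `(π, κ, d, e)`,
  `π^p = κ^p = 1`, `p` an odd prime, `(π, κ) ≠ (1,1)`, with `f` fixed columns, is — after re-signing and bordering — an array of
  `m = (N − f)/p` circulant cores: there are `m` sequences `a_1, …, a_m : ZMod p → {±1}` (a free row read along the column
  cycles) with `Σ_k PAF_{a_k}(s) = −f` for every `s ≠ 0` (`p·m = N − f`).
Then the H(668) census values (`hadamard668_fixedRows_13/37/41/83`, gens 6–9) give the explicit shapes
(**`hadamard668_pafFamily_13 / _37 / _41 / _83`**): order `13`: `48` sequences of length `13`, sum `−44`; order `37`: `18`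
sequences of length `37`, sum `−2`; order `41`: `16` of length `41`, sum `−12`; order `83`: `8` of length `83`, sum `−4`
(order `167`: `4` of length `167`, sum `0` — `Order167GSQuad668`; order `23` has the two census types `f ∈ {1, 24}`).
Finally the composite order `111 = 3·37` (**`hadamard668_order111_orbitType`**, **`hadamard668_pafFamily_111`**): the element
fixes exactly the `2` columns (rows) of its parts (`hadamard668_order111_structure`, gen 17, + `gcd (3, 37) = 1`) and every other
column is free of period `111`, so it is `6` sequences of length `111` with autocorrelation sum `−2` — the intermediate member of
the chain `37 → 111 → 333` (`18 → 6 → 2` sequences with sum `−2`; an LP(333) gives the other two by decimation, matching the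
powers `g⁹, g³` of an order-333 element `g`).  Dictionary / structure of a hypothetical object; no order excluded; H(668)
untouched.  Classical shape (regular cyclic action ⇒ circulant cores); statements ours; no `sorry`.
-/

namespace Summit.Ventures.DiscreteObjects.Hadamard

open Finset BigOperators Matrix

open Literature.Combinatorics.Designs.GoethalsSeidel (IsHadamardMatrix)
open Literature.Combinatorics.Designs.LegendrePairs (PAF IsPM)

variable {ι : Type*} [Fintype ι] [DecidableEq ι]

/-! ### general: odd prime order -/

/-- a nontrivial permutation moves some point -/
lemma exists_moved_of_ne_one {σ : Equiv.Perm ι} (h : σ ≠ 1) : ∃ x, σ x ≠ x := by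
  by_contra hall
  exact h (Equiv.ext fun x => by simpa using not_not.mp (not_exists.mp hall x))

/-- **Cyclic cores at an odd prime (general).**  A Hadamard matrix (any order) with a signed automorphism `(π, κ, d, e)`,
`π^p = κ^p = 1`, `p` an odd prime, `(π, κ) ≠ (1, 1)`: there are a transversal `T` of the moved columns (`p·|T| = #moved`) and
`±1` sequences `a_y : ZMod p → ℤ` (`y ∈ T`) with `Σ_{y∈T} PAF (a_y) s = −#Fix κ` for every `s ≠ 0`. -/
theorem hadamard_pafFamily_of_oddPrime {H : Matrix ι ι ℤ} (hH : IsHadamardMatrix H) {π κ : Equiv.Perm ι} {d e : ι → ℤ}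
    (haut : IsSignedAut H π κ d e) {p : ℕ} [NeZero p] (hp : p.Prime) (hodd : Odd p) (hπ : π ^ p = 1) (hκ : κ ^ p = 1)
    (hne : π ≠ 1 ∨ κ ≠ 1) :
    ∃ T : Finset ι, p * T.card = (univ.filter fun y => κ y ≠ y).card ∧
      ∃ a : {y // y ∈ T} → ZMod p → ℤ, (∀ y, IsPM (a y)) ∧
        ∀ s : ZMod p, s ≠ 0 → ∑ y, PAF (a y) s = -((univ.filter fun y => κ y = y).card : ℤ) := by
  -- π ≠ 1 (else κ = 1 as well)
  have hπ1 : π ≠ 1 := by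
    rcases isEmpty_or_nonempty ι with hι | hι
    · rcases hne with h | h <;> exact (h (Subsingleton.elim _ _)).elim
    · have hcard : (Fintype.card ι : ℤ) ≠ 0 := by exact_mod_cast Fintype.card_ne_zero
      have h := fst_pow_ne_one hH hcard haut (a := 1) hodd (by rw [pow_one]; exact hκ) (by rw [pow_one, pow_one]; exact hne)
      rwa [pow_one] at h
  obtain ⟨x₀, hx₀⟩ := exists_moved_of_ne_one hπ1
  have hfreeR : ∀ k, 0 < k → k < p → (π ^ k) x₀ ≠ x₀ :=
    free_of_fixed_prime_pow π hp (by rw [hπ, Equiv.Perm.one_apply]) hx₀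
  have hfreeC : ∀ y, κ y ≠ y → ∀ k, 0 < k → k < p → (κ ^ k) y ≠ y :=
    fun y hy => free_of_fixed_prime_pow κ hp (by rw [hκ, Equiv.Perm.one_apply]) hy
  exact exists_paf_family_signed hH haut hodd hπ hκ hfreeC hfreeR

/-- the moved-column count from the fixed-column count -/
lemma card_moved_eq_card_sub (σ : Equiv.Perm ι) {f : ℕ} (h : (univ.filter fun i => σ i = i).card = f) :
    (univ.filter fun i => σ i ≠ i).card = Fintype.card ι - f := by
  have := Finset.card_filter_add_card_filter_not (s := (univ : Finset ι)) (fun i => σ i = i)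
  rw [h, Finset.card_univ] at this
  have h' : (univ.filter fun i => ¬ σ i = i).card = Fintype.card ι - f := by omega
  exact h'

/-! ### H(668): the primes 13, 37, 41, 83 -/

section h668
variable {H : Matrix ι ι ℤ}

/-- common form of the four prime corollaries -/
private lemma pafFamily_668_prime (hH : IsHadamardMatrix H) (hι : Fintype.card ι = 668)
    {π κ : Equiv.Perm ι} {d e : ι → ℤ} (haut : IsSignedAut H π κ d e) {p f m : ℕ} [NeZero p] (hp : p.Prime) (hodd : Odd p)
    (hπ : π ^ p = 1) (hκ : κ ^ p = 1) (hne : π ≠ 1 ∨ κ ≠ 1)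
    (hfix : (univ.filter fun y => κ y = y).card = f) (hpm : p * m = 668 - f) :
    ∃ T : Finset ι, T.card = m ∧ ∃ a : {y // y ∈ T} → ZMod p → ℤ, (∀ y, IsPM (a y)) ∧
      ∀ s : ZMod p, s ≠ 0 → ∑ y, PAF (a y) s = -(f : ℤ) := by
  obtain ⟨T, hT, a, ha, hpaf⟩ := hadamard_pafFamily_of_oddPrime hH haut hp hodd hπ hκ hne
  rw [card_moved_eq_card_sub κ hfix, hι, ← hpm] at hT
  refine ⟨T, Nat.eq_of_mul_eq_mul_left hp.pos hT, a, ha, fun s hs => ?_⟩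
  rw [hpaf s hs, hfix]

/-- **order 13**: `48` sequences of length `13` with autocorrelation sum `−44` (44 fixed columns). -/
theorem hadamard668_pafFamily_13 (hH : IsHadamardMatrix H) (hι : Fintype.card ι = 668)
    (π κ : Equiv.Perm ι) (d e : ι → ℤ) (haut : IsSignedAut H π κ d e) (hπ : π ^ 13 = 1) (hκ : κ ^ 13 = 1)
    (hne : π ≠ 1 ∨ κ ≠ 1) :
    ∃ T : Finset ι, T.card = 48 ∧ ∃ a : {y // y ∈ T} → ZMod 13 → ℤ, (∀ y, IsPM (a y)) ∧
      ∀ s : ZMod 13, s ≠ 0 → ∑ y, PAF (a y) s = -44 :=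
  pafFamily_668_prime (m := 48) hH hι haut (by norm_num) (by decide) hπ hκ hne
    (hadamard668_fixedRows_13 hH hι π κ d e haut hπ hκ hne).2 (by norm_num)

/-- **order 37**: `18` sequences of length `37` with autocorrelation sum `−2` (2 fixed columns). -/
theorem hadamard668_pafFamily_37 (hH : IsHadamardMatrix H) (hι : Fintype.card ι = 668)
    (π κ : Equiv.Perm ι) (d e : ι → ℤ) (haut : IsSignedAut H π κ d e) (hπ : π ^ 37 = 1) (hκ : κ ^ 37 = 1)
    (hne : π ≠ 1 ∨ κ ≠ 1) :
    ∃ T : Finset ι, T.card = 18 ∧ ∃ a : {y // y ∈ T} → ZMod 37 → ℤ, (∀ y, IsPM (a y)) ∧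
      ∀ s : ZMod 37, s ≠ 0 → ∑ y, PAF (a y) s = -2 :=
  pafFamily_668_prime (m := 18) hH hι haut (by norm_num) (by decide) hπ hκ hne
    (hadamard668_fixedRows_37 hH hι π κ d e haut hπ hκ hne).2 (by norm_num)

/-- **order 41**: `16` sequences of length `41` with autocorrelation sum `−12` (12 fixed columns). -/
theorem hadamard668_pafFamily_41 (hH : IsHadamardMatrix H) (hι : Fintype.card ι = 668)
    (π κ : Equiv.Perm ι) (d e : ι → ℤ) (haut : IsSignedAut H π κ d e) (hπ : π ^ 41 = 1) (hκ : κ ^ 41 = 1)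
    (hne : π ≠ 1 ∨ κ ≠ 1) :
    ∃ T : Finset ι, T.card = 16 ∧ ∃ a : {y // y ∈ T} → ZMod 41 → ℤ, (∀ y, IsPM (a y)) ∧
      ∀ s : ZMod 41, s ≠ 0 → ∑ y, PAF (a y) s = -12 :=
  pafFamily_668_prime (m := 16) hH hι haut (by norm_num) (by decide) hπ hκ hne
    (hadamard668_fixedRows_41 hH hι π κ d e haut hπ hκ hne).2 (by norm_num)

/-- **order 83**: `8` sequences of length `83` with autocorrelation sum `−4` (4 fixed columns). -/
theorem hadamard668_pafFamily_83 (hH : IsHadamardMatrix H) (hι : Fintype.card ι = 668)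
    (π κ : Equiv.Perm ι) (d e : ι → ℤ) (haut : IsSignedAut H π κ d e) (hπ : π ^ 83 = 1) (hκ : κ ^ 83 = 1)
    (hne : π ≠ 1 ∨ κ ≠ 1) :
    ∃ T : Finset ι, T.card = 8 ∧ ∃ a : {y // y ∈ T} → ZMod 83 → ℤ, (∀ y, IsPM (a y)) ∧
      ∀ s : ZMod 83, s ≠ 0 → ∑ y, PAF (a y) s = -4 :=
  pafFamily_668_prime (m := 8) hH hι haut (by norm_num) (by decide) hπ hκ hne
    (hadamard668_fixedRows_83 hH hι π κ d e haut hπ hκ hne).2 (by norm_num)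

/-! ### H(668): order 111 = 3·37 -/

/-- columns, order 111: exactly `2` fixed columns, all other columns free of period `111` -/
lemma order111_cols_free (hH : IsHadamardMatrix H) (hι : Fintype.card ι = 668)
    {π κ : Equiv.Perm ι} {d e : ι → ℤ} (haut : IsSignedAut H π κ d e)
    (hπ : π ^ 111 = 1) (hκ : κ ^ 111 = 1) (h37 : π ^ 37 ≠ 1 ∨ κ ^ 37 ≠ 1) (h3 : π ^ 3 ≠ 1 ∨ κ ^ 3 ≠ 1) :
    (univ.filter fun y => κ y = y).card = 2 ∧ ∀ y, κ y ≠ y → ∀ k, 0 < k → k < 111 → (κ ^ k) y ≠ y := by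
  obtain ⟨-, hc37, -, hcint⟩ := hadamard668_order111_structure hH hι π κ d e haut hπ hκ h37 h3
  have h3π : (π ^ 3) ^ 37 = 1 := by rw [← pow_mul]; exact hπ
  have h3κ : (κ ^ 3) ^ 37 = 1 := by rw [← pow_mul]; exact hκ
  obtain ⟨-, hc3⟩ := hadamard668_fixedRows_37 hH hι (π ^ 3) (κ ^ 3) _ _ (isSignedAut_pow haut 3) h3π h3κ h3
  have hsub1 : (univ.filter fun y => (κ ^ 37) y = y ∧ (κ ^ 3) y = y) ⊆ univ.filter fun y => (κ ^ 3) y = y := by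
    intro y hy
    rw [Finset.mem_filter] at hy ⊢
    exact ⟨hy.1, hy.2.2⟩
  have hsub2 : (univ.filter fun y => (κ ^ 37) y = y ∧ (κ ^ 3) y = y) ⊆ univ.filter fun y => (κ ^ 37) y = y := by
    intro y hy
    rw [Finset.mem_filter] at hy ⊢
    exact ⟨hy.1, hy.2.1⟩
  have heq1 := Finset.eq_of_subset_of_card_le hsub1 (by rw [hc3, hcint])
  have heq2 := Finset.eq_of_subset_of_card_le hsub2 (by rw [hc37, hcint])
  -- a column fixed by κ³ and κ³⁷ is fixed by κ (gcd (3, 37) = 1)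
  have hboth : ∀ y, (κ ^ 37) y = y → (κ ^ 3) y = y → κ y = y := by
    intro y h37y h3y
    have h1 : Function.IsPeriodicPt κ 37 y := by
      show (⇑κ)^[37] y = y
      rw [Equiv.Perm.iterate_eq_pow]; exact h37y
    have h2 : Function.IsPeriodicPt κ 3 y := by
      show (⇑κ)^[3] y = y
      rw [Equiv.Perm.iterate_eq_pow]; exact h3y
    have h := h1.gcd h2
    have hg : (⇑κ)^[Nat.gcd 37 3] y = y := h
    rw [Equiv.Perm.iterate_eq_pow, show Nat.gcd 37 3 = 1 by decide, pow_one] at hg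
    exact hg
  have hfix3 : ∀ y, (κ ^ 3) y = y → κ y = y := by
    intro y hy
    have hm : y ∈ univ.filter fun y => (κ ^ 3) y = y := Finset.mem_filter.mpr ⟨Finset.mem_univ _, hy⟩
    rw [← heq1, Finset.mem_filter] at hm
    exact hboth y hm.2.1 hy
  have hfix37 : ∀ y, (κ ^ 37) y = y → κ y = y := by
    intro y hy
    have hm : y ∈ univ.filter fun y => (κ ^ 37) y = y := Finset.mem_filter.mpr ⟨Finset.mem_univ _, hy⟩
    rw [← heq2, Finset.mem_filter] at hm
    exact hboth y hy hm.2.2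
  have hFix : (univ.filter fun y => κ y = y) = univ.filter fun y => (κ ^ 3) y = y := by
    ext y
    simp only [Finset.mem_filter, Finset.mem_univ, true_and]
    exact ⟨fun h => perm_pow_apply_of_fixed κ h 3, hfix3 y⟩
  refine ⟨by rw [hFix, hc3], fun y hy => ?_⟩
  refine free_of_proper_divisors κ (by rw [hκ, Equiv.Perm.one_apply]) fun dd hdd hlt hfix => hy ?_
  have hmem : dd ∈ Nat.divisors 111 := Nat.mem_divisors.mpr ⟨hdd, by norm_num⟩
  have hcases : ∀ d ∈ Nat.divisors 111, d < 111 → d ∣ 3 ∨ d ∣ 37 := by decide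
  rcases hcases dd hmem hlt with ⟨m, hm⟩ | ⟨m, hm⟩
  · apply hfix3
    rw [hm, pow_mul]
    exact perm_pow_apply_of_fixed _ hfix m
  · apply hfix37
    rw [hm, pow_mul]
    exact perm_pow_apply_of_fixed _ hfix m

/-- **Order 111: the orbit type.**  A signed automorphism of an H(668) whose permutation pair has order exactly `111`
(`π^111 = κ^111 = 1`, `(π^37, κ^37) ≠ (1,1)`, `(π^3, κ^3) ≠ (1,1)`) fixes exactly `2` rows and `2` columns and every other row /
column is free of period `111` (`6 + 6` regular orbits). -/
theorem hadamard668_order111_orbitType (hH : IsHadamardMatrix H) (hι : Fintype.card ι = 668)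
    (π κ : Equiv.Perm ι) (d e : ι → ℤ) (haut : IsSignedAut H π κ d e)
    (hπ : π ^ 111 = 1) (hκ : κ ^ 111 = 1) (h37 : π ^ 37 ≠ 1 ∨ κ ^ 37 ≠ 1) (h3 : π ^ 3 ≠ 1 ∨ κ ^ 3 ≠ 1) :
    ((univ.filter fun x => π x = x).card = 2 ∧ ∀ x, π x ≠ x → ∀ k, 0 < k → k < 111 → (π ^ k) x ≠ x) ∧
    ((univ.filter fun y => κ y = y).card = 2 ∧ ∀ y, κ y ≠ y → ∀ k, 0 < k → k < 111 → (κ ^ k) y ≠ y) := by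
  have hcard : (Fintype.card ι : ℤ) ≠ 0 := by rw [hι]; norm_num
  exact ⟨order111_cols_free (isHadamard_transpose hH hcard) hι (isSignedAut_transpose haut) hκ hπ h37.symm h3.symm,
    order111_cols_free hH hι haut hπ hκ h37 h3⟩

/-- **order 111**: `6` sequences of length `111` with autocorrelation sum `−2` (2 fixed columns, `6` regular column orbits). -/
theorem hadamard668_pafFamily_111 (hH : IsHadamardMatrix H) (hι : Fintype.card ι = 668)
    (π κ : Equiv.Perm ι) (d e : ι → ℤ) (haut : IsSignedAut H π κ d e)
    (hπ : π ^ 111 = 1) (hκ : κ ^ 111 = 1) (h37 : π ^ 37 ≠ 1 ∨ κ ^ 37 ≠ 1) (h3 : π ^ 3 ≠ 1 ∨ κ ^ 3 ≠ 1) :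
    ∃ T : Finset ι, T.card = 6 ∧ ∃ a : {y // y ∈ T} → ZMod 111 → ℤ, (∀ y, IsPM (a y)) ∧
      ∀ s : ZMod 111, s ≠ 0 → ∑ y, PAF (a y) s = -2 := by
  obtain ⟨⟨hrow, hrowfree⟩, hcol, hcolfree⟩ := hadamard668_order111_orbitType hH hι π κ d e haut hπ hκ h37 h3
  have hmovedR := card_moved_eq_card_sub π hrow
  rw [hι] at hmovedR
  obtain ⟨x₀, hx₀m⟩ : ∃ x₀, x₀ ∈ univ.filter fun x => π x ≠ x :=
    Finset.card_pos.mp (by rw [hmovedR]; norm_num)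
  have hx₀ := hrowfree x₀ (Finset.mem_filter.mp hx₀m).2
  obtain ⟨T, hTcard, a, ha, hpaf⟩ := exists_paf_family_signed hH haut (by decide : Odd 111) hπ hκ hcolfree hx₀
  rw [card_moved_eq_card_sub κ hcol, hι] at hTcard
  refine ⟨T, by omega, a, ha, fun s hs => ?_⟩
  rw [hpaf s hs, hcol]
  norm_num

end h668

end Summit.Ventures.DiscreteObjects.Hadamard
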